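import Summits.Ventures.PercRepro.RankLevelSetCircuitUnionRank
import Summits.Ventures.PercRepro.RankLevelSetConfinement
import Summits.Ventures.PercRepro.RankLevelSetSubsetsConfined

/-!
# PercRepro — FORM (ii) OF THE CONFINEMENT LEMMA: the coindependent independent `6`-sets are confined to the union of the
triangles (p8 g12, S3)

`proofs/P8-G12-LEVER22.md` §3 (ii), §7. For `S ⊆ E` of rank `r` and nullity `ν = |S| − r` every `B ∈ U` has `|B ∖ S| ≤ d − ν`
(THE CONFINEMENT LEMMA), so the coindependent independent `6`-sets number at most `Σ_{b ≤ d − ν} C(n − |S|, b)·C(|S|, 6 − b)`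
(`ncard_indep_six_coindep_le_confined`). For `S₃` = the union of the triangles of an `e`-free core: `3·r(S₃) ≤ 2·|S₃|` (g11's
small-circuit union lemma at `k = 3`, i.e. `|S₃| ≤ 3·ν(S₃)`) and `#{triangles} ≤ cq3 ν(S₃)` (p3's table on `M ↾ S₃`, e-free by
`free_restrict`): `triangles_union_facts`. Axioms: standard.
-/

open scoped Matroid

namespace PercRepro

namespace ThmN

open Set

variable {α : Type}

/-- **The coindependent independent `6`-sets are confined to `S` up to `d − ν(S)` points.** -/
theorem ncard_indep_six_coindep_le_confined (M : Matroid α) [M.Finite] {S : Set α} (hS : S ⊆ M.E)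
    {p d rS ν : ℕ} (hn : M.E.ncard = p + d) (hrS : M.eRk S = (rS : ℕ∞)) (hSn : S.ncard = rS + ν)
    (hνd : ν ≤ d) :
    {B : Set α | B ⊆ M.E ∧ B.ncard = 6 ∧ M.eRk (M.E \ B) = (p : ℕ∞)}.ncard ≤
      ∑ b ∈ Finset.range (d - ν + 1), (p + d - S.ncard).choose b * S.ncard.choose (6 - b) := by
  classical
  have hEcard : M.ground_finite.toFinset.card = p + d := by
    rw [← Set.ncard_eq_toFinset_card _ M.ground_finite]; exact hn
  have hS' : S ⊆ (M.ground_finite.toFinset : Set α) := by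
    rw [Set.Finite.coe_toFinset]; exact hS
  have hsub : {B : Set α | B ⊆ M.E ∧ B.ncard = 6 ∧ M.eRk (M.E \ B) = (p : ℕ∞)} ⊆
      {W : Set α | W ⊆ (M.ground_finite.toFinset : Set α) ∧ W.ncard = 6 ∧ (W \ S).ncard ≤ d - ν} := by
    rintro B ⟨hBE, hB6, hspan⟩
    refine ⟨by rw [Set.Finite.coe_toFinset]; exact hBE, hB6, ?_⟩
    have key := ncard_diff_diff_add_ncard_le_of_spanning M (A := M.E \ B) sdiff_subset hS hn hspan hrS
    rw [sdiff_sdiff_cancel_left hBE] at key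
    omega
  have hfin : {W : Set α | W ⊆ (M.ground_finite.toFinset : Set α) ∧ W.ncard = 6 ∧ (W \ S).ncard ≤ d - ν}.Finite :=
    (M.ground_finite.toFinset.finite_toSet.finite_subsets).subset (fun W hW => hW.1)
  have hle := Set.ncard_le_ncard hsub hfin
  have hcount := ncard_subsets_confined_le M.ground_finite.toFinset S hS' 6 (d - ν)
  rw [hEcard] at hcount
  exact hle.trans hcount

/-- **The union of the triangles of an `e`-free core**: its rank `r` and nullity `ν` satisfy `3r ≤ 2|S₃|`
(so `|S₃| ≤ 3ν`) and `#{triangles} ≤ cq3 ν`. -/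
theorem triangles_union_facts (M : Matroid α) [M.Finite]
    (hfree : ∀ e ∈ M.E, ∃ A ⊆ M.E \ {e}, e ∉ M.closure A ∧ e ∉ M.closure ((M.E \ {e}) \ A)) :
    (⋃ C ∈ {C : Set α | M.IsCircuit C ∧ C.ncard = 3}, C) ⊆ M.E ∧
    ∃ r ν : ℕ, M.eRk (⋃ C ∈ {C : Set α | M.IsCircuit C ∧ C.ncard = 3}, C) = (r : ℕ∞) ∧
      (⋃ C ∈ {C : Set α | M.IsCircuit C ∧ C.ncard = 3}, C).ncard = r + ν ∧
      3 * r ≤ 2 * (⋃ C ∈ {C : Set α | M.IsCircuit C ∧ C.ncard = 3}, C).ncard ∧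
      {C : Set α | M.IsCircuit C ∧ C.ncard = 3}.ncard ≤ TriangleCap.cq3 ν := by
  classical
  set 𝒮 : Set (Set α) := {C : Set α | M.IsCircuit C ∧ C.ncard = 3} with h𝒮
  have h𝒮fin : 𝒮.Finite := M.ground_finite.finite_subsets.subset (fun C hC => hC.1.subset_ground)
  have hUeq : (⋃ C ∈ h𝒮fin.toFinset, C) = ⋃ C ∈ 𝒮, C := by
    ext x
    simp only [Set.mem_iUnion, exists_prop, Set.Finite.mem_toFinset]
  set S := ⋃ C ∈ 𝒮, C with hSdef
  have hS : S ⊆ M.E := by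
    intro x hx
    simp only [hSdef, Set.mem_iUnion, exists_prop] at hx
    obtain ⟨C, hC, hxC⟩ := hx
    exact hC.1.subset_ground hxC
  have hSfin : S.Finite := M.ground_finite.subset hS
  obtain ⟨r, hr⟩ := exists_eRk_eq_nat M S
  have hkr : 3 * r ≤ (3 - 1) * S.ncard := by
    have := mul_eRk_biUnion_circuits_le M 3 h𝒮fin.toFinset
      (fun C hC => by rw [Set.Finite.mem_toFinset] at hC; exact ⟨hC.1, hC.2.le⟩) (r := r) (by rw [hUeq]; exact hr)
    rwa [hUeq] at this
  have hrS : r ≤ S.ncard := by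
    have := M.eRk_le_encard S
    rw [hr, ← hSfin.cast_ncard_eq] at this
    exact_mod_cast this
  obtain ⟨ν, hν⟩ : ∃ ν, S.ncard = r + ν := ⟨S.ncard - r, by omega⟩
  refine ⟨hS, r, ν, hr, hν, by omega, ?_⟩
  haveI hNfin : (M ↾ S).Finite := ⟨by rw [Matroid.restrict_ground_eq]; exact hSfin⟩
  have htri : {C : Set α | M.IsCircuit C ∧ C.ncard = 3} = {C : Set α | (M ↾ S).IsCircuit C ∧ C.ncard = 3} := by
    ext C
    simp only [Set.mem_setOf_eq]
    constructor
    · rintro ⟨hC, h3⟩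
      refine ⟨(Matroid.restrict_isCircuit_iff hS).2 ⟨hC, ?_⟩, h3⟩
      intro x hx
      simp only [hSdef, Set.mem_iUnion, exists_prop]
      exact ⟨C, ⟨hC, h3⟩, hx⟩
    · rintro ⟨hC, h3⟩
      exact ⟨((Matroid.restrict_isCircuit_iff hS).1 hC).1, h3⟩
  have hdN : (M ↾ S).E.encard = (M ↾ S).eRank + ν := by
    rw [Matroid.restrict_ground_eq, Matroid.eRank_restrict, hr, ← hSfin.cast_ncard_eq, hν]
    push_cast; rfl
  have h1 := TriangleCap.core_ncard_triangles_le_cq3 (M ↾ S) (free_restrict M hfree hS) hdN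
  rw [h𝒮, htri]
  exact h1

/-- **The packaged bound**: on an `e`-free core of rank `p`, corank `d`, there are `ν ≤ d` and `σ ≤ 3ν` (the nullity and
the size of the union of the triangles) with `#{triangles} ≤ cq3 ν` and the coindependent independent `6`-sets numbering at
most `Σ_{b ≤ d − ν} C(p + d − σ, b)·C(σ, 6 − b)`. -/
theorem exists_triangle_union_bound (M : Matroid α) [M.Finite]
    (hfree : ∀ e ∈ M.E, ∃ A ⊆ M.E \ {e}, e ∉ M.closure A ∧ e ∉ M.closure ((M.E \ {e}) \ A))
    {p d : ℕ} (hR : M.eRank = (p : ℕ∞)) (hn : M.E.ncard = p + d) :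
    ∃ ν σ : ℕ, ν ≤ d ∧ σ ≤ 3 * ν ∧ σ ≤ p + d ∧
      {C : Set α | M.IsCircuit C ∧ C.ncard = 3}.ncard ≤ TriangleCap.cq3 ν ∧
      {B : Set α | B ⊆ M.E ∧ B.ncard = 6 ∧ M.eRk (M.E \ B) = (p : ℕ∞)}.ncard ≤
        ∑ b ∈ Finset.range (d - ν + 1), (p + d - σ).choose b * σ.choose (6 - b) := by
  classical
  obtain ⟨hS, r, ν, hr, hSn, h3r, hcq⟩ := triangles_union_facts M hfree
  set S := ⋃ C ∈ {C : Set α | M.IsCircuit C ∧ C.ncard = 3}, C with hSdef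
  have hd : M.E.encard = M.eRank + d := by
    rw [hR, ← M.ground_finite.cast_ncard_eq, hn]; push_cast; rfl
  have hνd : ν ≤ d := by
    have h1 := Matroid.encard_le_eRk_add_of_encard_eq hS hd
    rw [hr, ← (M.ground_finite.subset hS).cast_ncard_eq, hSn] at h1
    have h2 : r + ν ≤ r + d := by exact_mod_cast h1
    omega
  have hσn : S.ncard ≤ p + d := by rw [← hn]; exact Set.ncard_le_ncard hS M.ground_finite
  refine ⟨ν, S.ncard, hνd, by omega, hσn, hcq, ?_⟩
  exact ncard_indep_six_coindep_le_confined M hS hn hr hSn hνd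

/-- `cq3 ν < 7` below `ν = 5`. -/
theorem cq3_lt_seven_of_lt_five (ν : ℕ) (h : ν < 5) : TriangleCap.cq3 ν < 7 := by
  interval_cases ν <;> decide
/-- `cq3 ν < 8` below `ν = 6`. -/
theorem cq3_lt_eight_of_lt_six (ν : ℕ) (h : ν < 6) : TriangleCap.cq3 ν < 8 := by
  interval_cases ν <;> decide
/-- `cq3 ν < 11` below `ν = 7`. -/
theorem cq3_lt_eleven_of_lt_seven (ν : ℕ) (h : ν < 7) : TriangleCap.cq3 ν < 11 := by
  interval_cases ν <;> decide
/-- `cq3 ν < 12` below `ν = 8`. -/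
theorem cq3_lt_twelve_of_lt_eight (ν : ℕ) (h : ν < 8) : TriangleCap.cq3 ν < 12 := by
  interval_cases ν <;> decide

end ThmN

end PercRepro
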